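import Mathlib
import Summits.NavierStokesRegularity.NavierStokesRegularity.Theorems.OrthantWakeOrthantInvariance
import Summits.NavierStokesRegularity.NavierStokesRegularity.Theorems.OrthantWakeOrthantBreakOfWake
import HarnessLib

/-!
# `OrthantWake.OrthantHopWake` — REPAIR CENSUS, kernel-checked part: a POINTWISE ratchet already
gives the orthant conjunct (helper file for item stmt-NavierStokesRegularity-24639; `--supports`)

The crux `OrthantHopWake` (item 24639) asks for a per-hop tail-energy ratchet with constants
`η, κ₁, ε̄` depending on the spread `R` ONLY — uniform in the viscosity `ν > 0`, in
`ε₀ ≤ ε̄(R)`, in the orthant table `α ∈ E₂(R)` and in the datum. The glue already landed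
(`orthantBreakOfWake_proof`, item 24641) consumes much less. This file records, kernel-checked,
the WEAKEST ratchet that the landed machinery turns into the orthant conjunct of the rung target:

* `orthantBreak_of_pointwiseRatchet` — fix `ε₀ > 0`, a table `α ∈ E₂(R)` with the Kamke property
  and a datum `X₀`. If for EVERY `ν > 0` there are `η = η(ε₀,ν,α,X₀) > 0` and a transient depth
  `n₁ = n₁(ε₀,ν,α,X₀) ∈ ℕ` such that every regular non-negative `ν`-viscous solution on every
  window ratchets beyond `n₁` (`T_{n+1}(t) ≤ (1+ε₀)^{-(1+η)} T_n(u)` for some `u ≤ t`), then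
  `¬ NoGlobalCascade ε₀ α X₀`. No uniformity in `ν`, `ε₀`, `α`, `X₀` is used — only uniformity
  over the window `[0,s]`, the time `t ≤ s` and the solution (which, by uniqueness of regular
  viscous solutions, is no restriction either).
* `orthantConjunct_of_pointwiseRatchet` — the same in the shape of the route's orthant conjunct
  (`∀ R ≥ 1, ∃ εR > 0, ∀ ε₀ ≤ εR, …`), from the pointwise ratchet asserted below a threshold
  `εR(R)`.
* `pointwiseRatchet_of_orthantHopWake` — the crux as typed implies the pointwise ratchet (so the
  repair is a genuine WEAKENING of item 24639 that still closes the conjunct).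

Use (planner): if the `R`-uniform crux resists or is refuted by a spread-dependent family, the
item can be RESTATED as the hypothesis of `orthantConjunct_of_pointwiseRatchet` without touching
the assembly: `closes` needs only the conjunct.

HONEST FRAMING: statements about Tao-type MODEL lattice ODEs (route OrthantWake, rung TL-M2Break);
the ratchet itself (in any form) is NOT proved here; nothing bears on Navier–Stokes regularity.
-/

noncomputable section

-- the sub-problem namespace `NavierStokesRegularity.NavierStokesRegularity` is the tree's layout (D-0017)
set_option linter.dupNamespace false

namespace Summit.NavierStokesRegularity.NavierStokesRegularity.Theorems

open Set Filter
open scoped Topology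
open Literature.Analysis.FluidPDE.TaoCascade

/-- **A pointwise ratchet suffices.** For `ε₀ > 0`, a table `α ∈ E₂(R)` with the Kamke property
and a datum `X₀`: if for every viscosity `ν > 0` some margin `η > 0` and transient depth `n₁`
(both allowed to depend on `ε₀, ν, α, X₀`) make every regular, non-negative-above-the-datum
`ν`-viscous solution on every window ratchet beyond shell `n₁`, then Theorem-4.2-level blow-up
fails: `¬ NoGlobalCascade ε₀ α X₀`. Proof: κ-normal form, `ν = κ/√2`, cone invariance
(`orthantInvariance_proof`), energy bound + ratchet ⇒ envelope (`orthantBreak_envelope`),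
envelope smoothing, `hasGlobal_of_viscousGlobal`. [this file] -/
theorem orthantBreak_of_pointwiseRatchet {ε₀ R : ℝ} (hε₀ : 0 < ε₀)
    {α : Fin 4 → Fin 4 → Fin 4 → ℤ × ℤ × ℤ → ℝ} (hα : InTableClass R α)
    (hK : ∀ (Y : Fin 4 → ℤ → ℝ → ℝ) (τ : ℝ), (∀ (j : Fin 4) (k : ℤ), 1 ≤ k → 0 ≤ Y j k τ) →
      ∀ δ : ℝ, 0 < δ → ∀ (i : Fin 4) (n : ℤ), 1 ≤ n → Y i n τ = 0 → 0 ≤ quadTerm δ α Y i n τ)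
    (X₀ : Fin 4 → ℝ)
    (hrat : ∀ ν : ℝ, 0 < ν → ∃ η : ℝ, 0 < η ∧ ∃ n₁ : ℕ, ∀ s : ℝ, 0 < s →
      ∀ X : Fin 4 → ℤ → ℝ → ℝ,
      (∀ (i : Fin 4) (k : ℤ), X i k 0 = if k = 0 then X₀ i else 0) →
      (∀ (i : Fin 4) (k : ℤ), k < 0 → ∀ t : ℝ, X i k t = 0) →
      (∃ M : ℝ, ∀ (t : ℝ) (i : Fin 4) (k : ℤ), (1 + (1 + ε₀) ^ ((10 : ℝ) * k)) * |X i k t| ≤ M) →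
      (∀ (i : Fin 4) (k : ℤ), Continuous (X i k)) →
      (∀ (i : Fin 4) (k : ℤ), ∀ t ∈ Icc (0 : ℝ) s, HasDerivWithinAt (X i k)
        (quadTerm ε₀ α X i k t - ν * (1 + ε₀) ^ ((2 : ℝ) * k) * X i k t) (Icc (0 : ℝ) s) t) →
      (∀ t ∈ Icc (0 : ℝ) s, ∀ (i : Fin 4) (k : ℤ), 1 ≤ k → 0 ≤ X i k t) →
      ∀ n : ℕ, n₁ ≤ n → ∀ t ∈ Icc (0 : ℝ) s, ∃ u ∈ Icc (0 : ℝ) t,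
        (∑' j : ℕ, ∑ i : Fin 4, (1 / 2 : ℝ) * X i ((n + 1 : ℕ) + (j : ℤ)) t ^ 2) ≤
          (1 + ε₀) ^ (-(1 + η)) *
            (∑' j : ℕ, ∑ i : Fin 4, (1 / 2 : ℝ) * X i ((n : ℕ) + (j : ℤ)) u ^ 2)) :
    ¬ NoGlobalCascade ε₀ α X₀ := by
  intro hNG
  obtain ⟨κ, hκ, hno⟩ := (noGlobalCascade_iff_kappa hε₀).1 hNG
  have h2 : 0 < Real.sqrt 2 := Real.sqrt_pos.2 two_pos
  have hν : 0 < κ / Real.sqrt 2 := div_pos hκ h2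
  obtain ⟨η, hη, n₁, H⟩ := hrat (κ / Real.sqrt 2) hν
  have hI := orthantInvariance_proof
  unfold Summit.NavierStokesRegularity.NavierStokesRegularity.Theses.OrthantWake.OrthantInvariance
    at hI
  have hn₁ : ε₀ * n₁ ≤ ε₀ * (n₁ : ℝ) := le_rfl
  obtain ⟨X, hX⟩ := exists_viscousGlobal_of_subcriticalEnvelope_of_inTableClass hε₀.le hη hν hα X₀
    (fun T _hT => ⟨(∑ i : Fin 4, (1 / 2 : ℝ) * X₀ i ^ 2) * (1 + ε₀) ^ ((1 + η) * n₁),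
      fun s hs Y hinit hlow hbd hcont hder n N _hnN t ht => by
        obtain ⟨M, hM⟩ := hbd
        have hnonneg := hI ε₀ (κ / Real.sqrt 2) hε₀ hν α hK X₀ s hs.1 Y hinit hlow ⟨M, hM⟩
          hcont hder
        have hratY : ∀ n : ℕ, ε₀ * n₁ ≤ ε₀ * n → ∀ t ∈ Icc (0 : ℝ) s, ∃ u ∈ Icc (0 : ℝ) t,
            (∑' j : ℕ, ∑ i : Fin 4, (1 / 2 : ℝ) * Y i ((n + 1 : ℕ) + (j : ℤ)) t ^ 2) ≤
              (1 + ε₀) ^ (-(1 + η)) *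
                (∑' j : ℕ, ∑ i : Fin 4, (1 / 2 : ℝ) * Y i ((n : ℕ) + (j : ℤ)) u ^ 2) := by
          intro n hn
          have hn' : n₁ ≤ n := by
            have := le_of_mul_le_mul_left hn hε₀
            exact_mod_cast this
          exact H s hs.1 Y hinit hlow ⟨M, hM⟩ hcont hder hnonneg n hn'
        exact orthantBreak_envelope hε₀ hn₁ (orthantBreak_summable hε₀ hM)
          (fun u hu => orthantBreak_energy_le hε₀ hν hα.2.1 hinit hlow hM hder hu) hratY hη n N
          ht⟩)
  have hG := hasGlobal_of_viscousGlobal hε₀ hν.le hX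
  rw [div_mul_cancel₀ κ h2.ne'] at hG
  exact hno (hasGlobal_mono hε₀.le hG le_rfl hκ.le)

/-- **The orthant conjunct from a pointwise ratchet below a threshold.** If for every `R ≥ 1`
there is `εR ∈ (0,1]` such that for all `ε₀ ≤ εR`, `ν > 0`, orthant tables `α ∈ E₂(R)` and data
`X₀` a ratchet with margin and depth depending on `(ε₀, ν, α, X₀)` holds, then the orthant conjunct
of the rung target follows — the conclusion of the route item `OrthantBreakOfWake`, from a
hypothesis strictly weaker than `OrthantHopWake`. [this file] -/
theorem orthantConjunct_of_pointwiseRatchet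
    (hrat : ∀ R : ℝ, 1 ≤ R → ∃ εR : ℝ, 0 < εR ∧ εR ≤ 1 ∧ ∀ ε₀ : ℝ, 0 < ε₀ → ε₀ ≤ εR →
      ∀ ν : ℝ, 0 < ν → ∀ α : Fin 4 → Fin 4 → Fin 4 → ℤ × ℤ × ℤ → ℝ, InTableClass R α →
      (∀ (Y : Fin 4 → ℤ → ℝ → ℝ) (τ : ℝ), (∀ (j : Fin 4) (k : ℤ), 1 ≤ k → 0 ≤ Y j k τ) →
        ∀ δ : ℝ, 0 < δ → ∀ (i : Fin 4) (n : ℤ), 1 ≤ n → Y i n τ = 0 →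
          0 ≤ quadTerm δ α Y i n τ) →
      ∀ X₀ : Fin 4 → ℝ, ∃ η : ℝ, 0 < η ∧ ∃ n₁ : ℕ, ∀ s : ℝ, 0 < s →
      ∀ X : Fin 4 → ℤ → ℝ → ℝ,
      (∀ (i : Fin 4) (k : ℤ), X i k 0 = if k = 0 then X₀ i else 0) →
      (∀ (i : Fin 4) (k : ℤ), k < 0 → ∀ t : ℝ, X i k t = 0) →
      (∃ M : ℝ, ∀ (t : ℝ) (i : Fin 4) (k : ℤ), (1 + (1 + ε₀) ^ ((10 : ℝ) * k)) * |X i k t| ≤ M) →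
      (∀ (i : Fin 4) (k : ℤ), Continuous (X i k)) →
      (∀ (i : Fin 4) (k : ℤ), ∀ t ∈ Icc (0 : ℝ) s, HasDerivWithinAt (X i k)
        (quadTerm ε₀ α X i k t - ν * (1 + ε₀) ^ ((2 : ℝ) * k) * X i k t) (Icc (0 : ℝ) s) t) →
      (∀ t ∈ Icc (0 : ℝ) s, ∀ (i : Fin 4) (k : ℤ), 1 ≤ k → 0 ≤ X i k t) →
      ∀ n : ℕ, n₁ ≤ n → ∀ t ∈ Icc (0 : ℝ) s, ∃ u ∈ Icc (0 : ℝ) t,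
        (∑' j : ℕ, ∑ i : Fin 4, (1 / 2 : ℝ) * X i ((n + 1 : ℕ) + (j : ℤ)) t ^ 2) ≤
          (1 + ε₀) ^ (-(1 + η)) *
            (∑' j : ℕ, ∑ i : Fin 4, (1 / 2 : ℝ) * X i ((n : ℕ) + (j : ℤ)) u ^ 2)) :
    ∀ R : ℝ, 1 ≤ R → ∃ εR : ℝ, 0 < εR ∧ ∀ ε₀ : ℝ, 0 < ε₀ → ε₀ ≤ εR →
      ∀ (α : Fin 4 → Fin 4 → Fin 4 → ℤ × ℤ × ℤ → ℝ) (X₀ : Fin 4 → ℝ), InTableClass R α →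
      (∀ (Y : Fin 4 → ℤ → ℝ → ℝ) (τ : ℝ), (∀ (j : Fin 4) (k : ℤ), 1 ≤ k → 0 ≤ Y j k τ) →
        ∀ δ : ℝ, 0 < δ → ∀ (i : Fin 4) (n : ℤ), 1 ≤ n → Y i n τ = 0 →
          0 ≤ quadTerm δ α Y i n τ) →
      ¬ NoGlobalCascade ε₀ α X₀ := by
  intro R hR
  obtain ⟨εR, hεR, _hεR1, H⟩ := hrat R hR
  refine ⟨εR, hεR, fun ε₀ hε₀ hle α X₀ hα hK => ?_⟩
  exact orthantBreak_of_pointwiseRatchet hε₀ hα hK X₀ (fun ν hν => H ε₀ hε₀ hle ν hν α hα hK X₀)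

/-- **The crux as typed implies the pointwise ratchet** (with `εR = ε̄`, the same `η`, and depth
`n₁ = ⌈κ₁/ε₀⌉`): the repair hypothesis of `orthantConjunct_of_pointwiseRatchet` is a weakening
of `OrthantHopWake`. [this file] -/
theorem pointwiseRatchet_of_orthantHopWake
    (hW : Summit.NavierStokesRegularity.NavierStokesRegularity.Theses.OrthantWake.OrthantHopWake) :
    ∀ R : ℝ, 1 ≤ R → ∃ εR : ℝ, 0 < εR ∧ εR ≤ 1 ∧ ∀ ε₀ : ℝ, 0 < ε₀ → ε₀ ≤ εR →
      ∀ ν : ℝ, 0 < ν → ∀ α : Fin 4 → Fin 4 → Fin 4 → ℤ × ℤ × ℤ → ℝ, InTableClass R α →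
      (∀ (Y : Fin 4 → ℤ → ℝ → ℝ) (τ : ℝ), (∀ (j : Fin 4) (k : ℤ), 1 ≤ k → 0 ≤ Y j k τ) →
        ∀ δ : ℝ, 0 < δ → ∀ (i : Fin 4) (n : ℤ), 1 ≤ n → Y i n τ = 0 →
          0 ≤ quadTerm δ α Y i n τ) →
      ∀ X₀ : Fin 4 → ℝ, ∃ η : ℝ, 0 < η ∧ ∃ n₁ : ℕ, ∀ s : ℝ, 0 < s →
      ∀ X : Fin 4 → ℤ → ℝ → ℝ,
      (∀ (i : Fin 4) (k : ℤ), X i k 0 = if k = 0 then X₀ i else 0) →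
      (∀ (i : Fin 4) (k : ℤ), k < 0 → ∀ t : ℝ, X i k t = 0) →
      (∃ M : ℝ, ∀ (t : ℝ) (i : Fin 4) (k : ℤ), (1 + (1 + ε₀) ^ ((10 : ℝ) * k)) * |X i k t| ≤ M) →
      (∀ (i : Fin 4) (k : ℤ), Continuous (X i k)) →
      (∀ (i : Fin 4) (k : ℤ), ∀ t ∈ Icc (0 : ℝ) s, HasDerivWithinAt (X i k)
        (quadTerm ε₀ α X i k t - ν * (1 + ε₀) ^ ((2 : ℝ) * k) * X i k t) (Icc (0 : ℝ) s) t) →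
      (∀ t ∈ Icc (0 : ℝ) s, ∀ (i : Fin 4) (k : ℤ), 1 ≤ k → 0 ≤ X i k t) →
      ∀ n : ℕ, n₁ ≤ n → ∀ t ∈ Icc (0 : ℝ) s, ∃ u ∈ Icc (0 : ℝ) t,
        (∑' j : ℕ, ∑ i : Fin 4, (1 / 2 : ℝ) * X i ((n + 1 : ℕ) + (j : ℤ)) t ^ 2) ≤
          (1 + ε₀) ^ (-(1 + η)) *
            (∑' j : ℕ, ∑ i : Fin 4, (1 / 2 : ℝ) * X i ((n : ℕ) + (j : ℤ)) u ^ 2) := by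
  unfold Summit.NavierStokesRegularity.NavierStokesRegularity.Theses.OrthantWake.OrthantHopWake at hW
  intro R hR
  obtain ⟨η, hη, κ₁, _hκ₁, εb, hεb, hεb1, H⟩ := hW R hR
  refine ⟨εb, hεb, hεb1, fun ε₀ hε₀ hle ν hν α hα hK X₀ => ⟨η, hη, ⌈κ₁ / ε₀⌉₊, ?_⟩⟩
  intro s hs X hinit hlow hbd hcont hder hnonneg n hn t ht
  have hκn : κ₁ ≤ ε₀ * n := by
    have h1 : κ₁ / ε₀ ≤ n := (Nat.le_ceil (κ₁ / ε₀)).trans (by exact_mod_cast hn)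
    rwa [div_le_iff₀' hε₀] at h1
  exact H ε₀ hε₀ hle ν hν α hα hK X₀ s hs X hinit hlow hbd hcont hder hnonneg n hκn t ht

end Summit.NavierStokesRegularity.NavierStokesRegularity.Theorems

end
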